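import Summits.ValiantsHypothesis.ValiantsHypothesis.Theses.TauConst
import Summits.ValiantsHypothesis.ValiantsHypothesis.Theorems.RealTauAssemblyOfKoiran
import Summits.ValiantsHypothesis.ValiantsHypothesis.Theorems.RealTauRefinedImpliesHard
import Summits.ValiantsHypothesis.ValiantsHypothesis.Theorems.RealTauRealVnTransfer

/-!
# TauConst, support item `TauRealValiant` (stmt-ValiantsHypothesis-10713) — PROVED

Route `TauConst` of `ValiantsHypothesis`, support item `TauRealValiant` (Tavenas 2014, Thm. 3.38
over `ℂ`): Koiran's real τ-conjecture (the body of `Theses.RealTau.TauReal`, inlined as the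
hypothesis) implies that `L_ℂ(PER_n)` — the circuit complexity `complexity` of the generic
permanent over `ℂ`, arbitrary complex constants allowed — is not p-bounded.

Proof — a citation of the (closed) items of the sister route `RealTau`, whose theorem files carry
out exactly the printed argument (Cor. 3.37 for the `P`-definable Hutchinson family `V_n`, the
depth-four reduction with constants over `ℝ`, realification of complex constants):

* `Theorems.RealTau.ofKoiran_proof` (`OfKoiran`): Koiran's form `(k+m+t+2)^c` implies Tavenas'
  refined form `2^{a(m+1)} (k+t+2)^a` (`RealTauRefined`);
* `Theorems.RealTau.refinedImpliesHard_proof` (`RefinedImpliesHard`): the refined form gives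
  `VnSparseHard` — for every exponent `C`, infinitely many `n` for which `V_n` has no real
  `ΣΠ`-sparse expression of Tavenas size `C`;
* `Theorems.RealTauRealVnTransfer.realVnTransfer_proof` (`RealVnTransfer`): if `(per_n)` is
  p-computable over `ℂ` (which is, by definition of `IsPComputable`, the negation of the item's
  conclusion) then for one `C` EVERY `V_n` has such an expression.

Honest framing: Koiran's real τ-conjecture is an open problem; VP ≠ VNP is NOT proved and nothing
here is progress on it — this closes a conditional support item by citation.
-/

noncomputable section

-- the summit and the problem share the name `ValiantsHypothesis` (D-0017 single-conjunct layout)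
set_option linter.dupNamespace false

namespace Summit.ValiantsHypothesis.ValiantsHypothesis.Theorems.TauConst

open Literature.Computability.AlgebraicComplexity

/-- **`TauRealValiant` (stmt-ValiantsHypothesis-10713, Tavenas 2014 Thm. 3.38 over `ℂ`):** Koiran's
real τ-conjecture implies that `L_ℂ(PER_n)` is not p-bounded — composition of the `RealTau` route
theorems `ofKoiran_proof`, `refinedImpliesHard_proof` and `realVnTransfer_proof`. -/
theorem tauRealValiant_proof :
    Summit.ValiantsHypothesis.ValiantsHypothesis.Theses.TauConst.TauRealValiant := by
  intro hK hPB
  -- p-bounded `complexity` of `(per_n)` over `ℂ` is `IsPComputable` by definition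
  have hP : IsPComputable (fun n => perPoly (Fin n) ℂ) := hPB
  obtain ⟨C, hC⟩ :=
    Summit.ValiantsHypothesis.ValiantsHypothesis.Theorems.RealTauRealVnTransfer.realVnTransfer_proof hP
  obtain ⟨n, -, hn⟩ :=
    Summit.ValiantsHypothesis.ValiantsHypothesis.Theorems.RealTau.refinedImpliesHard_proof
      (Summit.ValiantsHypothesis.ValiantsHypothesis.Theorems.RealTau.ofKoiran_proof hK) C 0
  obtain ⟨k, m, t, g, hk, hm, ht, hg, hsum⟩ := hC n
  exact hn k m t g hk hm ht hg hsum

end Summit.ValiantsHypothesis.ValiantsHypothesis.Theorems.TauConst
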